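import Summits.BirchSwinnertonDyer.Rank1Residual.Additive.CyclotomicPrimeReduction
import Literature.NumberTheory.EllipticCurves.SelmerInertia
import Mathlib.NumberTheory.NumberField.Cyclotomic.Ideal
import HarnessLib

/-!
# `(ζ_p − 1)^{p−1} = −p·η` with `η ≡ 1 (mod ζ_p − 1)`: the principal unit attached to the
# uniformizer `ζ_p − 1` of `ℚ(ζ_p)` at `p`

HONEST FRAMING (cell `b2b-bsdres`, run/shared/lean/b2b/bsd-rank1-residual/, verbatim in every
file): the goal of the cell is to DELETE the COMBINATION-SHAPED residual classes of the
Birch–Swinnerton-Dyer formula for ALL analytic-rank `≤ 1` elliptic curves over `ℚ` — "full BSD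
formula for every rank `≤ 1` curve in class `C`" assembled STRICTLY from published theorems — so
that the rank-`≤ 1` remainder becomes exactly the CONSTRUCTION-SHAPED classes, which are TYPED
(missing-input `Prop`s), NOT attempted. This is not "finishing BSD". Sub-cell `additive-p2`
(X3♯(G-ord) / X4♯(G-ord)), generation 36, part 2: research route; no claim beyond the stated
classes; theorems only, no definition, no named fact, nothing booked, no label moved.

## What is proved

The cyclotomic input of gen 34's LAW 4 (the normalisation `(−p)^{v}` of the explicit special fibre
`α = −27c₄/(−p)^{v_p(c₄)}`, `β = −54c₆/(−p)^{v_p(c₆)}` over the minimal (G)-field): Mathlib knows that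
`(ζ − 1)^{p−1}` and `p` are ASSOCIATED in `𝓞 ℚ(ζ_p)` (`IsCyclotomicExtension.Rat.associated_zeta_sub_one_pow_prime`);
the (G)-cell needs the RESIDUE of the unit, which is `−1`:

* `exists_mul_sub_one_pow_add_mul_eq_zero` — for any commutative ring `R`, prime `p` and `z ∈ R` with
  `z^p = 1`: `(z − 1)·((z − 1)^{p−1} + p·η) = 0` for some `η` with `z − 1 ∣ η − 1` (binomial
  expansion of `((z − 1) + 1)^p = 1`: the middle binomial coefficients are divisible by `p`);
* `exists_zeta_sub_one_pow_eq_neg_mul` — in `𝓞 K`, `K` a `p`-th cyclotomic field: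
  **`(ζ − 1)^{p−1} = −p·η` with `ζ − 1 ∣ η − 1`**;
* `exists_zeta_sub_one_pow_eq_neg_mul_residue_eq_one` — at the place `𝔭 ∋ p` of `K` (`𝔭 = (ζ − 1)`):
  `η ≡ 1` in the residue field `k_𝔭` of the completion, `ζ − 1 ∈ 𝔭`, and in `K`:
  `(ζ − 1)^{p−1} = −p·η`, so that **`η^v·(n·(−p)^v) = n·(ζ − 1)^{(p−1)v}`** is an `e`-th power times
  `n` for every `e ∣ p − 1` (`neg_p_pow_mul_eq`, the form consumed by part 3).

References: L. C. Washington, *Introduction to Cyclotomic Fields*, GTM 83, Lemma 1.4 and proof of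
Prop. 2.1 / §6.3 eq. before Lemma 6.10 (`π^{p−1} ≡ −p`); B. Dwork's uniformizer `π^{p−1} = −p`.
-/

noncomputable section

open scoped Classical NumberField

open IsDedekindDomain IsDedekindDomain.HeightOneSpectrum NumberField IsLocalRing Finset

namespace Summit.BirchSwinnertonDyer.Rank1Residual.Additive

/-! ### The binomial identity -/

/-- **`(z − 1)·((z − 1)^{p−1} + p·η) = 0` with `η ≡ 1 (mod z − 1)`** whenever `z^p = 1` (`p` prime), in
any commutative ring: expand `((z − 1) + 1)^p = 1` binomially; `C(p, k)` is divisible by `p` for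
`1 < k < p`, so those terms are divisible by `p·(z − 1)²`. [folklore] -/
theorem exists_mul_sub_one_pow_add_mul_eq_zero {R : Type*} [CommRing R] {p : ℕ} (hp : p.Prime)
    {z : R} (hz : z ^ p = 1) :
    ∃ η : R, (z - 1) * ((z - 1) ^ (p - 1) + p * η) = 0 ∧ (z - 1) ∣ η - 1 := by
  obtain ⟨m, rfl⟩ : ∃ m, p = m + 1 + 1 := ⟨p - 2, by have := hp.two_le; omega⟩
  set π := z - 1 with hπ
  have hz' : z = π + 1 := by rw [hπ]; ring
  have key : ∑ k ∈ range (m + 1 + 1 + 1),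
      π ^ k * (1 : R) ^ (m + 1 + 1 - k) * ((m + 1 + 1).choose k : R) = 1 := by
    rw [← add_pow, ← hz', hz]
  -- the middle terms are divisible by `p π²`
  have hmid : ((m + 1 + 1 : ℕ) : R) * π ^ 2 ∣ ∑ k ∈ range m,
      π ^ (k + 1 + 1) * (1 : R) ^ (m + 1 + 1 - (k + 1 + 1)) * ((m + 1 + 1).choose (k + 1 + 1) : R) := by
    refine dvd_sum fun k hk ↦ ?_
    have hk' : k + 1 + 1 < m + 1 + 1 := by rw [mem_range] at hk; omega
    obtain ⟨c, hc⟩ := hp.dvd_choose_self (by omega : k + 1 + 1 ≠ 0) hk'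
    exact ⟨(c : R) * π ^ k, by rw [hc]; push_cast; ring⟩
  obtain ⟨S, hS⟩ := hmid
  rw [sum_range_succ', sum_range_succ, sum_range_succ', hS] at key
  simp only [one_pow, mul_one, pow_zero, Nat.choose_zero_right, Nat.cast_one, zero_add, pow_one,
    Nat.choose_one_right, Nat.choose_self] at key
  refine ⟨1 + π * S, ?_, ⟨S, by ring⟩⟩
  rw [show m + 1 + 1 - 1 = m + 1 from rfl]
  linear_combination key

/-! ### In `𝓞 ℚ(ζ_p)` -/

section Cyclotomic

variable (p : ℕ) [hp : Fact p.Prime] {K : Type*} [Field K] [NumberField K]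
  [IsCyclotomicExtension {p} ℚ K] {ζ : K} (hζ : IsPrimitiveRoot ζ p)
include hζ

omit [NumberField K] [IsCyclotomicExtension {p} ℚ K] in
/-- **`(ζ − 1)^{p−1} = −p·η` in `𝓞 K` with `ζ − 1 ∣ η − 1`** (`K` a `p`-th cyclotomic field, `ζ` a
primitive `p`-th root of unity): the binomial identity in the domain `𝓞 K`, where `ζ ≠ 1`.
Washington, *Cyclotomic Fields*, Lemma 1.4 (`(1 − ζ)^{p−1}/p` is a unit) with the residue made
explicit. [cite: Washington1997, Lemma 1.4] -/
theorem exists_zeta_sub_one_pow_eq_neg_mul :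
    ∃ η : 𝓞 K, (hζ.toInteger - 1) ^ (p - 1) = -(p : 𝓞 K) * η ∧ (hζ.toInteger - 1) ∣ η - 1 := by
  have hz : hζ.toInteger ^ p = 1 := hζ.toInteger_isPrimitiveRoot.pow_eq_one
  obtain ⟨η, hη, hdvd⟩ := exists_mul_sub_one_pow_add_mul_eq_zero hp.out hz
  have hne : hζ.toInteger - 1 ≠ 0 :=
    sub_ne_zero.mpr (hζ.toInteger_isPrimitiveRoot.ne_one hp.out.one_lt)
  refine ⟨η, ?_, hdvd⟩
  have h := (mul_eq_zero.mp hη).resolve_left hne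
  linear_combination h

/-- **At the place `𝔭 ∋ p` of `K = ℚ(ζ_p)`**: `ζ − 1 ∈ 𝔭` (indeed `𝔭 = (ζ − 1)`, Mathlib
`IsCyclotomicExtension.Rat.eq_span_zeta_sub_one_of_liesOver'`), and there is `η ∈ 𝓞 K` with
**`(ζ − 1)^{p−1} = −p·η` in `K` and `η ≡ 1` in the residue field of `O_𝔭`**.
[cite: Washington1997, Lemma 1.4] -/
theorem exists_zeta_sub_one_pow_eq_neg_mul_residue_eq_one (𝔭 : HeightOneSpectrum (𝓞 K))
    (h𝔭 : (p : 𝓞 K) ∈ 𝔭.asIdeal) :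
    (hζ.toInteger - 1) ∈ 𝔭.asIdeal ∧
      ∃ η : 𝓞 K, ((hζ.toInteger : K) - 1) ^ (p - 1) = -(p : K) * (η : K) ∧
        residue (𝔭.adicCompletionIntegers K) (algebraMap (𝓞 K) (𝔭.adicCompletionIntegers K) η) = 1 := by
  haveI : 𝔭.asIdeal.LiesOver (Ideal.span {((p : ℕ) : ℤ)}) :=
    Ideal.liesOver_span_of_natCast_mem' hp.out h𝔭
  have hspan : 𝔭.asIdeal = Ideal.span {hζ.toInteger - 1} :=
    IsCyclotomicExtension.Rat.eq_span_zeta_sub_one_of_liesOver' p K hζ 𝔭.asIdeal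
  have hmem : hζ.toInteger - 1 ∈ 𝔭.asIdeal := by
    rw [hspan]; exact Ideal.mem_span_singleton_self _
  obtain ⟨η, hη, hdvd⟩ := exists_zeta_sub_one_pow_eq_neg_mul p hζ
  refine ⟨hmem, η, ?_, ?_⟩
  · have h := congrArg (fun x : 𝓞 K ↦ (x : K)) hη
    simpa using h
  · have h1 : η - 1 ∈ 𝔭.asIdeal := by
      rw [hspan, Ideal.mem_span_singleton]; exact hdvd
    have h2 := (algebraMap_mem_maximalIdeal_adicCompletionIntegers_iff (v := 𝔭) (η - 1)).mpr h1
    rw [← residue_eq_zero_iff, map_sub, map_sub, map_one, sub_eq_zero] at h2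
    exact h2

omit [NumberField K] [IsCyclotomicExtension {p} ℚ K] in
/-- **The form consumed by the special-fibre theorems**: with `η` as above, `e ∣ p − 1` and
`x = n·(−p)^v` in `K`, **`η^v · x = (ζ − 1)^{((p−1)/e)·v·e} · n`**, i.e.
`η^v·(n·(−p)^v) = ((ζ − 1)^{((p−1)/e)·v})^e · n`. [folklore] -/
theorem neg_p_pow_mul_eq {η : 𝓞 K} (hη : ((hζ.toInteger : K) - 1) ^ (p - 1) = -(p : K) * (η : K))
    {e : ℕ} (he : e ∣ p - 1) (n : ℤ) (v : ℕ) :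
    (η : K) ^ v * ((n : K) * (-(p : K)) ^ v) =
      (((hζ.toInteger : K) - 1) ^ ((p - 1) / e * v)) ^ e * (n : K) := by
  obtain ⟨d, hd⟩ := he
  have hd' : (p - 1) / e * v * e = (p - 1) * v := by
    rcases Nat.eq_zero_or_pos e with rfl | hepos
    · simp [hd]
    · rw [hd, Nat.mul_div_cancel_left d hepos]; ring
  rw [← pow_mul, hd', pow_mul, hη]
  ring

end Cyclotomic

end Summit.BirchSwinnertonDyer.Rank1Residual.Additive

end
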